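import Mathlib
import HarnessLib
import HarnessLib.Audit
import Summits.QuantumFields.Statement
import Summits.QuantumFields.YangMills.Theorems.SoloInformedU1HelicityTorus
import Literature.MathematicalPhysics.QuantumFieldTheory.AbelianTorusCochains
import HarnessLib.Audit.Status.Attr

/-!
Route: TransverseWardBL

# Route TransverseWardBL — Ward pinning of the exact sector plus transverse Brascamp–Lieb gives the
Wilson U(1)4 torus helicity gap

LINE (D-0145 ideator seat ym-idea-4 g9, card «spectral / trace methods»; no summit is proved by a
line) onto the EXISTING leaf
`Summit.QuantumFields.YangMills.Theorems.U1HelicityGapTorusD4` (bears_on: LADDER-YM §1c BARRIER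
ledger `AbelianMasslessPhaseD4` via the tree theorems
`u1HelicityGapD4_of_torus` and `abelianMasslessPhaseD4_of_u1HelicityGapTorusD4`; not a rung toward
`YangMills`). It suffices to show X = X1 ∧ X2 on the
TRANSVERSE (co-closed) sector of plaquette test forms of the periodic Wilson `U(1)` theory on
`(ℤ/(M+1))⁴`, uniformly in `M` at large `β`:
X1 (`ConvexPhaseTransverseBound`): in the small-field CUT theory (all `cos θ_p ≥ cos 1`, a
log-concave measure sector by sector) `β⟨(u,sin θ)²⟩ ≤ (9/20)|u|²`
for co-closed `u`; X2 (`LargeFieldInsensitivity`): removing the cut moves `β⟨(u,sin θ)²⟩` by at most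
`|u|²/20`. The exact (longitudinal) sector needs NO estimate:
the Haar integration-by-parts (Ward) identity pins it EXACTLY at `⟨cos θ⟩·|dα|²` and decouples it
from every co-closed `u` (support `WardPinning`); the Hodge split of
the box form (support `BoxHodgeSplit`, exact and transverse halves each `≤ (1/2+ε)#B_N`) and `⟨cos
θ⟩ ≥ 9/10` (support) then give the node with `δ = 1/10`.
Lean: `Summit.QuantumFields.YangMills.Theorems.U1HelicityGapTorusD4`

## Assembly
Logic + real arithmetic, kernel-checked (Sketch.lean / Inlined.lean in the seat folder, rc 0, c. 35
lines; to be landed at once as the proof of the Assembly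
item): β₁* = max(β₁(X1), β₁(X2), β₂, 1), δ = 1/10, ε = 1/20; from BoxHodgeSplit get h = dα + u;
BoxSecondMoment + WardPinning give β·torusBoxVar = c|dα|² + β⟨f_u²⟩
with c = torusMeanPlaq; X1 + X2 and ⟨1_G⟩ > 0 give β⟨f_u²⟩ ≤ |u|²/2; with |dα|², |u|² ≤ (11/20)#B_N
and c ≥ 9/10: c·(11/20) + 11/40 ≤ c − 1/10. The deciding
theorem `closes hA h0 h1 h2a h2b h3 h4` applies the Assembly item to the six items; its conclusion
is the leaf `U1HelicityGapTorusD4`, NOT the sub-problem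
Statement (draft-by-design LINE, as WilsonVillainDualStiffness / U1DipoleHelicity /
ThermalTraceWindow).

Rationale: WHY THIS LINE. Mechanism: write the box electric flux `h = dα + u` (Hodge on the torus 2-cochains).
By `u1_torus_ward_identity` (tree, `U1WardIdentity.lean`: `⟨X_e F⟩ = β⟨F·X_e S⟩`,
`X_e S = Σ_p (dε_e)_p sin θ_p`) with `F = Σ_p w_p sin θ_p` and hypercubic invariance of the torus
state (`⟨cos θ_p⟩` independent of `p`), `β⟨f_w f_(dα)⟩ = ⟨cos θ⟩(w,dα)`
for every `w`: the exact sector saturates the Gaussian value identically and is orthogonal (in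
covariance) to the co-closed sector, where the spin-wave contribution
vanishes (`(u,dφ)=0`). The helicity gap is therefore EQUIVALENT to a volume-uniform bound on the
transverse electric susceptibility, whose true size is `O(β⁻²)|u|²`
(two-loop) against a budget `(⟨cos θ⟩−2δ)|u|² ≈ |u|²`. Bulk tool imported from convex analysis /
statistical mechanics of log-concave measures: Brascamp–Lieb
(BrascampLieb1976) / Helffer–Sjöstrand (HelfferSjostrand1994) on the torus `U(1)^E` lifted
sector-wise to exact 2-cochains: with the co-closed shift
`w' = u ⊙ (cos θ − 1)` the BL quadratic form gives `β Var ≤ ⟨Σ_p u_p²(1−cos θ_p)²/cos θ_p⟩ ≤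
0.391|u|²` pointwise on the cut event, and Prékopa log-concavity of the
flux-sector partition function controls the harmonic (toron-flux) means — this is X1,
dimension-blind and convexity-only. All `d = 4` Coulomb-phase content
(dilute, BOUND monopole loops ⇒ no screening of the defect dipole field) is isolated in X2 with
`O(1)` slack; in `d = 3` X1 still holds and X2 fails (GopfertMack1982),
so the split is sharp. Versus the listed U(1) lines: U1DipoleHelicity (pointwise renormalised dipole
law, multiscale) and WilsonVillainDualStiffness (dual integer
currents + Hartman–Watson annealing + lattice-Gaussian monotonicity) both estimate the FULL
variance; this line uses neither duality nor annealing nor an expansion of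
the action: integration by parts kills the longitudinal sector exactly and log-concavity bounds the
transverse one (FrohlichSpencer1982 fn. 3 / Guth1980 treat Villain,
where global convexity is free). Nearest use of BL near gauge theories: DurhuusFrohlich1980 §4
(lower bounds on `β_c` of σ-models in external gauge fields —
strong-coupling side) and DarioWu2020 Prop. 2.1 (BL/HS for the DUAL Villain rotator); none on the
transverse sector of the Wilson gauge measure.

RANKED CRUXES. #2 LargeFieldInsensitivity (crux) — Deciding crux X2. There is β₁ such that for all β
> β₁, all M and every co-closed plaquette form u on (ℤ/(M+1))⁴: |β⟨f_u²⟩·⟨1_G⟩ − β⟨f_u² 1_G⟩| ≤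
(1/20)|u|²⟨1_G⟩, where f_u = Σ_p u_p sin θ_p, G = {∀p, cos θ_p ≥ cos 1} and ⟨·⟩ is the torus Wilson
U(1) expectation; i.e. conditioning on the small-field event changes the transverse electric
susceptibility by ≤ |u|²/(20β). [difficulty: XL] (why it might fail: u ranges over ALL scales: if
large-field defects (monopole loops live only there) SCREEN, ⟨(u,θ_defect)²⟩/|u|² grows like (scale
of u)²·m_D² and the uniform 1/20 fails — exactly what happens in d=3 (Göpfert–Mack); d=4 needs loop
diluteness+binding for Wilson, unpublished (FS82 fn.3).) [FrohlichSpencer1982, Guth1980,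
GopfertMack1982]
#3 ConvexPhaseTransverseBound (crux) — X1. There is β₁ such that for all β > β₁, all M and every
co-closed u: 0 < ⟨1_G⟩ and β⟨f_u² 1_G⟩ ≤ (9/20)|u|²⟨1_G⟩ — the transverse susceptibility of the
small-field cut theory (weight e^(βΣcos θ)·1_G, log-concave on each flux sector of exact 2-cochains)
is at most 9/20 per unit norm, uniformly in the volume (Brascamp–Lieb with the co-closed shift w' =
u⊙(cos θ−1): pointwise constant (1−cos 1)²/cos 1 = 0.391, plus Prékopa control of toron-flux sector
means for harmonic u). [difficulty: L] (why it might fail: BL needs a convex domain: after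
quotienting gauge/closed directions each sector {|dφ−2πm|∞≤1} is convex, but harmonic u see
flux-sector MEANS ≈ 2πnL²; if the cut sector weights Z_n/Z_0 do not decay like e^(−cβ) uniformly in
L, the 9/20 − 0.391 slack is eaten at moderate β.) [BrascampLieb1976, HelfferSjostrand1994,
DarioWu2020]
#9 WardPinning (support) — The Ward lever (provable now from `u1_torus_ward_identity` +
translation/hyperoctahedral invariance of the torus Wilson state + bilinearity/integrability): for β
> 0, all M, every real 1-cochain α and every co-closed u, β·⟨f_(dα+u)²⟩ = torusMeanPlaq(β,M)·|dα|² +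
β·⟨f_u²⟩ (exact sector pinned at the mean plaquette, zero covariance with the transverse sector).
[difficulty: M] [Guth1980, FrohlichSpencer1982]
#9 BoxSecondMoment (support) — Bookkeeping: the node's `torusBoxVar β M N` equals ⟨f_h²⟩ for the box
form h_(N,M)(y;0,1) = #{x ∈ B_N : x ≡ y mod M+1} (other orientations 0): bilinearity of the finite
double sum, `toTorusObservable`/`torusLift` periodisation of `u1PlaqIm`, integrability of bounded
continuous observables. [difficulty: provable-now] [FrohlichSpencer1982]
#9 BoxHodgeSplit (support) — Hodge split of the box form on the torus 2-cochains with the sharing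
fraction 1/2: for every ε > 0, for N ≥ N₀(ε) and M ≥ M₀(N,ε) there are a real 1-cochain α and a
co-closed u with h_(N,M) = dα + u pointwise, |dα|² ≤ (1/2+ε)#B_N and |u|² ≤ (1/2+ε)#B_N (lattice
Plancherel on (ℤ/(M+1))⁴: exact fraction of a (0,1)-form has symbol (k̂₀²+k̂₁²)/|k̂|², whose Fejér
average over a cube → 2/4; shares the limit computation with U1DipoleHelicity's
`FreeDipoleBoxMeanHalf`). [difficulty: M] [FrohlichSpencer1982, Guth1980]
#9 TorusMeanPlaqLower (support) — For β > β₂ and all M, torusMeanPlaq(β,M) ≥ 9/10 (Ginibre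
comparison torus ≥ one plaquette, tree `U1GinibreComparison`, and I₁(β)/I₀(β) ≥ 1 − 1/(2β) − …).
[difficulty: provable-now] [Guth1980]

TWO-LAYER PLAN. X1 ⇐ stub_brascampLiebSector (BL per flux sector with slack 1/50 for sector means) →
stub_integrandBound (pointwise (1−cos θ)²/cos θ ≤ 2/5 on G, monotonicity,
⟨1_G⟩ > 0) → X1 (skeleton bc/K2a_birth.lean, rc 0, sorries = 2 stubs). X2 ⇐ stub_defectTail
(chessboard/RP exponential tail for large-field plaquette sets, uniform
in M) → stub_responseFromTail (tail ⇒ transverse response ≤ |u|²/20: conditional BL outside the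
defects + no screening of the defect dipole field) → X2 (skeleton
bc/K2b_birth.lean, rc 0, sorries = 3 stubs incl. the BC5 rung stub_rung_singleCell). Nothing of this
is filed now.

KILL CRITERIA. A refutation of LargeFieldInsensitivity (e.g. a volume sequence and co-closed forms
u_M with β|⟨f²⟩−⟨f²⟩_G| / |u_M|² ≥ 1/20 at all large β) closes the route
(`refuted:LargeFieldInsensitivity`) and is itself informative (it would exhibit screening-like
transverse response in d = 4). A refutation of ConvexPhaseTransverseBound
through the harmonic/toron sector forces a pivot to the co-exact-only version (add the six harmonic
constraints to u and a separate toron-flux item). If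
U1HelicityGapTorusD4 is proved elsewhere (WilsonVillainDualStiffness) the line is moot as a closer
but X1/X2 remain of independent interest; a proof of ¬U1HelicityGapTorusD4
kills all three U(1) lines.

NOT DECOMPOSED YET. The flux-sector (toron) bookkeeping inside X1, the precise chessboard constant κ
in the defect tail, measurability/integrability side conditions of the cut
indicator, and the hyperoctahedral-invariance lemma for the torus Wilson state used by WardPinning
are layer-2 / prover-level; the constants 9/20, 1/20, 9/10, 1/2+ε
have O(1) slack against the true values (0.391·e^(−cβ)-corrections, β e^(−cβ), 1 − 1/(4β)).

CHEAPEST FALSIFIER. Monte-Carlo instrument row (pre-registered for the critic): Wilson U(1) on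
(ℤ/4)⁴ and (ℤ/6)⁴ at β ∈ {1.1, 1.5, 2, 3}, measure R(u) = β⟨(u,sin θ)²⟩/|u|² and its cut
version R_G for (a) u = signed faces of one 3-cell, (b) u = δ of a dual plane wave at the lowest
momentum, (c) u = harmonic (0,1)-indicator; the line dies if
R − R_G or R_G exceeds 1/20 resp. 9/20 and GROWS from L = 4 to L = 6 at β ≥ 1.5 (expected: R ≈
3/(16β²) ≲ 0.1, R − R_G ≈ β e^(−cβ) ≪ 0.05). Exact check already
possible in-tree: on the 2⁴ torus WardPinning is a finite-dimensional integral identity (sanity of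
the single-count / orientation conventions).

NUMBERS. (1−cos 1)²/cos 1 = 0.3911 (BL pointwise constant on G) < 2/5; budget split 9/20 + 1/20 =
1/2; Hodge sharing fraction 1/2 (+ε = 1/20 ⇒ 11/20); ⟨cos θ⟩ ≥ 9/10 needs
I₁/I₀(β) ≥ 0.9, i.e. β ≳ 5.3 for the one-plaquette lower bound; final margin c·11/20 + 11/40 ≤ c −
1/10 ⇔ c ≥ 5/6.

DEFINITION REQUESTS. None: all functionals are inlined over `wilsonExpectation`,
`plaquetteHolonomy`, `LatticeForm.td₁/res`, `box` (no new notion needed); a named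
`transverseSusceptibility` def would only be cosmetic.

Novelty: Searches (2026-08-28): lit search --hybrid "Brascamp-Lieb inequality lattice gauge theory Wilson
action U(1) four dimensions" (6 docs, all textbooks, no BL-for-gauge
hit); lit search "Brascamp-Lieb gauge" --source local (5 docs; 1 relevant:
[corpus:paper:url-7617d647c36c p13] = DurhuusFrohlich1980); lit galaxy search
"Brascamp-Lieb|Helffer-Sjöstrand|Helffer-Sjostrand" --star pdf (8 hits, none gauge: log-concave
geometry / KPZ / entropy); earlier this session: [corpus:arxiv-2204.12737 p5]
ShenZhuZhu2023 (Bakry–Émery/Poincaré for lattice YM at STRONG coupling only, Ric(U(1)) = 0),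
[galaxy:pdf:4804124834982672200 p36] DarioWu2020 Prop 2.1 (BL + HS
representation for the dual Villain rotator, convex case); no hits for "transverse susceptibility" ∧
"Ward identity" ∧ "lattice gauge" in corpus(fts+vec) and galaxy.
Nearest prior art found: DurhuusFrohlich1980 §4 (BL for σ-models in external gauge fields ⇒ lower
bounds on β_c: strong-coupling direction); DarioWu2020 (BL/HS on the
dual, globally convex Villain model); FrohlichSpencer1982 / Guth1980 (Villain U(1)₄ massless phase
by duality + renormalisation, Wilson extension announced in fn. 3,
never printed).
Delta: the Ward identity is used to REMOVE the longitudinal sector exactly so that log-concavity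
tools only ever see the transverse sector, where the Gaussian part
vanishes and an O(1) budget suffices; BL is applied to the primal Wilson measure on its small-field
(convex) event, with all non-convexity quarantined in one
defect-ins  [refs: paper:url-7617d647c36c, arxiv-2204.12737, DurhuusFrohlich1980, ShenZhuZhu2023, DarioWu2020, FrohlichSpencer1982, Guth1980]

Barriers (technique_class: ward-identity, log-concavity, brascamp-lieb, large-field): - technique_class: ward-identity, log-concavity, brascamp-lieb, large-field-decomposition
- Literature.Barriers.QuantumFields.AbelianDeconfinementD4: outside — the barrier kills technique
classes UNIFORM in the gauge group; every item here is U(1)-specific (abelian Hodge decomposition of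
2-cochains, log-concavity on U(1)^E, integer-free real Ward flows); the line attacks the barrier's
own open Wilson-action input (`AbelianMasslessPhaseD4`) rather than being subject to it.
- Literature.Barriers.QuantumFields.U1GaussLawRateBound: outside — it caps support-linear
exponential CLUSTERING rates (m ≤ 8c); no item asserts clustering; X1/X2 are susceptibility
(second-moment) bounds with no rate.
- Literature.Barriers.QuantumFields.ToronPlaneAnticorrelation: outside — it refutes
local-association (FKG-type) criteria for SU(N), N ≥ 2; the only correlation inequality used is
Ginibre for abelian U(1) (TorusMeanPlaqLower), where it holds; X1's toron-flux sectors are handled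
by Prékopa log-concavity, not association.
- Literature.Barriers.QuantumFields.ElitzurTheorem: outside — all functionals (f_u², 1_G, cos θ_p)
are gauge invariant; no gauge-variant order parameter is used.
- Negatives index: `ledger negatives --problem QuantumFields` has no statement on
transverse/co-closed electric susceptibilities, small-field cuts or log-concavity (grep
transverse|coclosed|Brascamp|log-concav|cutMass|helicity: empty at filing); the refuted
GluonFreeDual-type positivity claims (toron anticorrelation) a

History (route lifecycle, newest last):
- 2026-08-28T17:35:02Z · rev 2: informal re-worded for DefectTail (planner-ym-idea-4-g9-0)
- 2026-08-28T17:54:29Z · rev 3: informal re-worded for ResponseFromTail (planner-ym-idea-4-g9-0)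
- 2026-08-28T17:58:15Z · rev 4: informal re-worded for ResponseFromTail (planner-ym-idea-4-g9-0)
- 2026-08-28T18:44:13Z · rev 8: informal re-worded for InfraredBound (planner-ym-idea-4-g9-0)

sub-problem: YangMills · status: draft · opened planner-ym-idea-4-g9-0 2026-08-28T17:15:21Z · rev 9 · ledger route-QuantumFields-TransverseWardBL
GENERATED by the gate from the ledger (D-0016/17). Provers cite these decls: `theorem foo : Summit.QuantumFields.YangMills.Theses.TransverseWardBL.<Decl> := …` in Summits/QuantumFields/YangMills/Theorems/<Name>.lean.
-/

namespace Summit.QuantumFields.YangMills.Theses.TransverseWardBL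

open scoped BigOperators Topology Manifold Classical MeasureTheory ProbabilityTheory Matrix InnerProductSpace ComplexConjugate ContinuousMap
open Filter Set Function TopologicalSpace MeasureTheory

attribute [summit_statement] _root_.YangMills

/-- item stmt-QuantumFields-22928 · crux · rank 2 · SPLIT (gen 1) into DefectTail, ResponseFromTail + glue LargeFieldInsensitivityOfSplit · direct attempts still welcome (low priority) · by planner
why it might fail: u ranges over ALL scales: if large-field defects (monopole loops live only there) SCREEN, ⟨(u,θ_defect)²⟩/|u|² grows like (scale of u)²·m_D² and the uniform 1/20 fails — exactly what happens in d=3 (Göpfert–Mack); d=4 needs loop diluteness+binding for Wilson, unpublished (FS82 fn.3).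
sources: FrohlichSpencer1982, Guth1980, GopfertMack1982
[crux] Deciding crux X2. There is β₁ such that for all β > β₁, all M and every co-closed plaquette
form u on (ℤ/(M+1))⁴: |β⟨f_u²⟩·⟨1_G⟩ − β⟨f_u² 1_G⟩| ≤ (1/20)|u|²⟨1_G⟩, where f_u = Σ_p u_p sin θ_p,
G = {∀p, cos θ_p ≥ cos 1} and ⟨·⟩ is the torus Wilson U(1) expectation; i.e. conditioning on the
small-field event changes the transverse electric susceptibility by ≤ |u|²/(20β). [difficulty: XL] -/
@[route_item "route-QuantumFields-TransverseWardBL", crux]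
def LargeFieldInsensitivity : Prop :=
  ∃ β₁ : ℝ, ∀ β : ℝ, β₁ < β → ∀ M : ℕ, ∀ u : Literature.MathematicalPhysics.QuantumFieldTheory.Plaquette 4 (M + 1) → ℝ, (∀ e : Literature.MathematicalPhysics.QuantumFieldTheory.Edge 4 (M + 1), ∑ p : Literature.MathematicalPhysics.QuantumFieldTheory.Plaquette 4 (M + 1), (u) p * Literature.MathematicalPhysics.QuantumFieldTheory.LatticeForm.res (Literature.MathematicalPhysics.QuantumFieldTheory.LatticeForm.td₁ (fun (y : Literature.MathematicalPhysics.QuantumFieldTheory.Site 4 (M + 1)) (k : Fin 4) => if y = e.1 ∧ k = e.2 then (1 : ℝ) else 0)) p = 0) → |β * ((fun (β : ℝ) (M : ℕ) (w : Literature.MathematicalPhysics.QuantumFieldTheory.Plaquette 4 (M + 1) → ℝ) => Literature.MathematicalPhysics.QuantumFieldTheory.wilsonExpectation (L := M + 1) Literature.MathematicalPhysics.QuantumLattice.u1Rep β (fun U : Literature.MathematicalPhysics.QuantumFieldTheory.GaugeConfig 4 (M + 1) Circle => (∑ p : Literature.MathematicalPhysics.QuantumFieldTheory.Plaquette 4 (M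 + 1), (w) p * ((Literature.MathematicalPhysics.QuantumFieldTheory.plaquetteHolonomy U p.1 p.2.1.1 p.2.1.2 : Circle) : ℂ).im) ^ 2)) β M u) * ((fun (β : ℝ) (M : ℕ) => Literature.MathematicalPhysics.QuantumFieldTheory.wilsonExpectation (L := M + 1) Literature.MathematicalPhysics.QuantumLattice.u1Rep β (fun U : Literature.MathematicalPhysics.QuantumFieldTheory.GaugeConfig 4 (M + 1) Circle => (if (∀ p : Literature.MathematicalPhysics.QuantumFieldTheory.Plaquette 4 (M + 1), Real.cos 1 ≤ ((Literature.MathematicalPhysics.QuantumFieldTheory.plaquetteHolonomy U p.1 p.2.1.1 p.2.1.2 : Circle) : ℂ).re) then (1 : ℝ) else 0))) β M) - β * ((fun (β : ℝ) (M : ℕ) (w : Literature.MathematicalPhysics.QuantumFieldTheory.Plaquette 4 (M + 1) → ℝ) => Literature.MathematicalPhysics.QuantumFieldTheory.wilsonExpectation (L := M + 1) Literature.MathematicalPhysics.QuantumLattice.u1Rep β (fun U : Literature.MathematicalPhysics.QuantumFieldTheory.GaugeConfig 4 (M + 1) Circle => (∑ p : Literature.MathematicalPhysics.QuantumFieldTheory.Plaquette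 4 (M + 1), (w) p * ((Literature.MathematicalPhysics.QuantumFieldTheory.plaquetteHolonomy U p.1 p.2.1.1 p.2.1.2 : Circle) : ℂ).im) ^ 2 * (if (∀ p : Literature.MathematicalPhysics.QuantumFieldTheory.Plaquette 4 (M + 1), Real.cos 1 ≤ ((Literature.MathematicalPhysics.QuantumFieldTheory.plaquetteHolonomy U p.1 p.2.1.1 p.2.1.2 : Circle) : ℂ).re) then (1 : ℝ) else 0))) β M u)| ≤ (1 / 20 : ℝ) * (∑ p : Literature.MathematicalPhysics.QuantumFieldTheory.Plaquette 4 (M + 1), ((u) p) ^ 2) * ((fun (β : ℝ) (M : ℕ) => Literature.MathematicalPhysics.QuantumFieldTheory.wilsonExpectation (L := M + 1) Literature.MathematicalPhysics.QuantumLattice.u1Rep β (fun U : Literature.MathematicalPhysics.QuantumFieldTheory.GaugeConfig 4 (M + 1) Circle => (if (∀ p : Literature.MathematicalPhysics.QuantumFieldTheory.Plaquette 4 (M + 1), Real.cos 1 ≤ ((Literature.MathematicalPhysics.QuantumFieldTheory.plaquetteHolonomy U p.1 p.2.1.1 p.2.1.2 : Circle) : ℂ).re) then (1 : ℝ) else 0)))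 β M)

-- parent: LargeFieldInsensitivity · child (gen 1)
/--     item stmt-QuantumFields-23008 · crux · rank 201 · closed · proved by Summit.QuantumFields.YangMills.Theorems.TransverseWardBLDefect.defectTail_proof (planner)
    parent: LargeFieldInsensitivity · by planner
    why it might fail: Chessboard needs reflections in all four directions, i.e. EVEN side M+1, but the node quantifies every large M; on odd tori only the mixed site/bond reflection exists and a non-RP Peierls bound must replace it; the rate must be uniform in M and in the shape of P.
    sources: FrohlichIsraelLiebSimon1978, FrohlichSpencer1982, Guth1980
[crux] (split child 1 of LargeFieldInsensitivity; M, de-risked 2026-08-28) uniform exponential tail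
for large-field plaquette sets in Wilson U(1)_4 on every torus Z_{M+1}^4 (both parities): kappa > 0,
beta_1 with W_{beta,M}[prod_{p in P} 1{cos theta_p < cos 1}] <= exp(-kappa*beta*#P) for all M, P.
PROOF PLAN (Ginibre tilt, no chessboard, no parity restriction): prod_{p in P} 1{bent} <= exp(lambda
* sum_{p in P}(cos 1 - cos theta_p)) for lambda >= 0; E_beta[exp(-lambda sum_P cos theta_p)] =
Z(J_lambda)/Z(beta) with couplings J_lambda = beta - lambda on P, beta elsewhere; d/ds log Z(J_s) =
-sum_{p in P} <cos theta_p>_{J_s} and by Ginibre monotonicity in the couplings (tree: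
Literature.Probability.LatticeModels.ginibreExpect_reChar_mono via
wilsonExpectation_charRep_eq_ginibreExpect_of) <cos theta_p>_{J_s} >= torusMeanPlaq(beta - s, M) >=
9/10 for beta - s > beta_2 (item TorusMeanPlaqLower); take lambda = beta - beta_2 - 1: tail <=
exp(-(beta - beta_2 - 1)(9/10 - cos 1) #P) <= exp(-kappa beta #P) with kappa = 0.17 for beta >= 2
beta_2 + 2. Deps: TorusMeanPlaqLower. Also the input of the BC5 rung stub_rung_singleCell. -/
@[route_item "route-QuantumFields-TransverseWardBL"]
def DefectTail : Prop :=
  ∃ κ : ℝ, 0 < κ ∧ ∃ β₁ : ℝ, ∀ β : ℝ, β₁ < β → (∀ M : ℕ, ∀ P : Finset (Literature.MathematicalPhysics.QuantumFieldTheory.Plaquette 4 (M + 1)), Literature.MathematicalPhysics.QuantumFieldTheory.wilsonExpectation (L := M + 1) Literature.MathematicalPhysics.QuantumLattice.u1Rep β (fun U : Literature.MathematicalPhysics.QuantumFieldTheory.GaugeConfig 4 (M + 1) Circle => ∏ p ∈ P, (if ((Literature.MathematicalPhysics.QuantumFieldTheory.plaquetteHolonomy U p.1 p.2.1.1 p.2.1.2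 : Circle) : ℂ).re < Real.cos 1 then (1 : ℝ) else 0)) ≤ Real.exp (-(κ * β * (P.card : ℝ))))

-- `DefectTail` holds: proved by `Summit.QuantumFields.YangMills.Theorems.TransverseWardBLDefect.defectTail_proof` (its module imports this route file, so no `_holds` link can be stated here).

-- parent: LargeFieldInsensitivity · child (gen 1)
/--     item stmt-QuantumFields-23009 · crux · rank 202 · open
    parent: LargeFieldInsensitivity · by planner
    why it might fail: No Banks-Myerson-Kogut factorisation for Wilson's action: 'Gaussian + projected defect field' must come from a cluster expansion around bent plaquettes (activity e^{-kappa beta} vs beta x response); a resonance between nearby defects and slow transverse modes could exceed the 1/20 budget.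
    sources: FrohlichSpencer1982, GopfertMack1982, Guth1980, BrascampLieb1976
[crux] (split child 2 of LargeFieldInsensitivity; XL, THE load-bearing item after DefectTail 23008
was proved) transverse response to dilute defects: IF bent-plaquette sets have a uniform exponential
tail exp(-kappa*beta*#P), THEN removing the small-field cut changes beta<f_u^2> by at most |u|^2/20
* cutMass for every co-closed u, uniformly in M. MECHANISM (planner g9): (1) inside the cut |d
theta| <= 6 < 2 pi on every cube, so the Bianchi defect nu = d theta/(2 pi) (integer 3-form) lives
on cubes with a bent face; Peierls/lattice-animal counting from DefectTail makes connected bent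
clusters of size m exponentially rare, (C e^{-kappa beta})^m, uniformly in M. (2) LOCAL COUPLING
IDENTITY: theta = dA + h + P_coex theta, P_coex theta = 2 pi P_coex s for ANY integer 2-form s with
ds = nu; for CO-CLOSED u, (u, P_coex theta) = 2 pi (u, s) - 2 pi (P_harm u, s) (P_exact u = 0,
P_coex self-adjoint): the transverse test form couples to a defect through the LOCAL spanning
surface of its monopole loop, not through dipole kernels (d = 3 fails exactly here: nu point-like, s
= Dirac sheet of unbounded extent). (3) XL INPUT, correctly stated: a uniform-in-M bound beta *
sum_{q,q'} u_q u_q' <s_q ; -/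
@[route_item "route-QuantumFields-TransverseWardBL"]
def ResponseFromTail : Prop :=
  ∀ κ : ℝ, 0 < κ → (∃ β₁ : ℝ, ∀ β : ℝ, β₁ < β → (∀ M : ℕ, ∀ P : Finset (Literature.MathematicalPhysics.QuantumFieldTheory.Plaquette 4 (M + 1)), Literature.MathematicalPhysics.QuantumFieldTheory.wilsonExpectation (L := M + 1) Literature.MathematicalPhysics.QuantumLattice.u1Rep β (fun U : Literature.MathematicalPhysics.QuantumFieldTheory.GaugeConfig 4 (M + 1) Circle => ∏ p ∈ P, (if ((Literature.MathematicalPhysics.QuantumFieldTheory.plaquetteHolonomy U p.1 p.2.1.1 p.2.1.2 : Circle) : ℂ).re < Real.cos 1 then (1 : ℝ) else 0)) ≤ Real.exp (-(κ * β * (P.card : ℝ))))) → ∃ β₁ : ℝ, ∀ β : ℝ, β₁ < β → ∀ M : ℕ, ∀ u : Literature.MathematicalPhysics.QuantumFieldTheory.Plaquette 4 (M + 1) → ℝ, (∀ e : Literature.MathematicalPhysics.QuantumFieldTheory.Edge 4 (M + 1), ∑ p : Literature.MathematicalPhysics.QuantumFieldTheory.Plaquette 4 (M + 1), (u) p * Literature.MathematicalPhysics.QuantumFieldTheory.LatticeForm.res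 (Literature.MathematicalPhysics.QuantumFieldTheory.LatticeForm.td₁ (fun (y : Literature.MathematicalPhysics.QuantumFieldTheory.Site 4 (M + 1)) (k : Fin 4) => if y = e.1 ∧ k = e.2 then (1 : ℝ) else 0)) p = 0) → |β * ((fun (β : ℝ) (M : ℕ) (w : Literature.MathematicalPhysics.QuantumFieldTheory.Plaquette 4 (M + 1) → ℝ) => Literature.MathematicalPhysics.QuantumFieldTheory.wilsonExpectation (L := M + 1) Literature.MathematicalPhysics.QuantumLattice.u1Rep β (fun U : Literature.MathematicalPhysics.QuantumFieldTheory.GaugeConfig 4 (M + 1) Circle => (∑ p : Literature.MathematicalPhysics.QuantumFieldTheory.Plaquette 4 (M + 1), (w) p * ((Literature.MathematicalPhysics.QuantumFieldTheory.plaquetteHolonomy U p.1 p.2.1.1 p.2.1.2 : Circle) : ℂ).im) ^ 2)) β M u) * ((fun (β : ℝ) (M : ℕ) => Literature.MathematicalPhysics.QuantumFieldTheory.wilsonExpectation (L := M + 1) Literature.MathematicalPhysics.QuantumLattice.u1Rep β (fun U : Literature.MathematicalPhysics.QuantumFieldTheory.GaugeConfig 4 (M + 1) Circle => (if (∀ p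 : Literature.MathematicalPhysics.QuantumFieldTheory.Plaquette 4 (M + 1), Real.cos 1 ≤ ((Literature.MathematicalPhysics.QuantumFieldTheory.plaquetteHolonomy U p.1 p.2.1.1 p.2.1.2 : Circle) : ℂ).re) then (1 : ℝ) else 0))) β M) - β * ((fun (β : ℝ) (M : ℕ) (w : Literature.MathematicalPhysics.QuantumFieldTheory.Plaquette 4 (M + 1) → ℝ) => Literature.MathematicalPhysics.QuantumFieldTheory.wilsonExpectation (L := M + 1) Literature.MathematicalPhysics.QuantumLattice.u1Rep β (fun U : Literature.MathematicalPhysics.QuantumFieldTheory.GaugeConfig 4 (M + 1) Circle => (∑ p : Literature.MathematicalPhysics.QuantumFieldTheory.Plaquette 4 (M + 1), (w) p * ((Literature.MathematicalPhysics.QuantumFieldTheory.plaquetteHolonomy U p.1 p.2.1.1 p.2.1.2 : Circle) : ℂ).im) ^ 2 * (if (∀ p : Literature.MathematicalPhysics.QuantumFieldTheory.Plaquette 4 (M + 1), Real.cos 1 ≤ ((Literature.MathematicalPhysics.QuantumFieldTheory.plaquetteHolonomy U p.1 p.2.1.1 p.2.1.2 : Circle) : ℂ).re) then (1 : ℝ)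 else 0))) β M u)| ≤ (1 / 20 : ℝ) * (∑ p : Literature.MathematicalPhysics.QuantumFieldTheory.Plaquette 4 (M + 1), ((u) p) ^ 2) * ((fun (β : ℝ) (M : ℕ) => Literature.MathematicalPhysics.QuantumFieldTheory.wilsonExpectation (L := M + 1) Literature.MathematicalPhysics.QuantumLattice.u1Rep β (fun U : Literature.MathematicalPhysics.QuantumFieldTheory.GaugeConfig 4 (M + 1) Circle => (if (∀ p : Literature.MathematicalPhysics.QuantumFieldTheory.Plaquette 4 (M + 1), Real.cos 1 ≤ ((Literature.MathematicalPhysics.QuantumFieldTheory.plaquetteHolonomy U p.1 p.2.1.1 p.2.1.2 : Circle) : ℂ).re) then (1 : ℝ) else 0))) β M)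

-- parent: LargeFieldInsensitivity · glue (gen 1)
/--     item stmt-QuantumFields-23010 · support · rank 203 · closed · proved by Summit.QuantumFields.YangMills.Theorems.transverseWardBL_largeFieldInsensitivityOfSplit (planner)
    parent: LargeFieldInsensitivity · GLUE: children ⟹ parent · by planner
DefectTail → ResponseFromTail → LargeFieldInsensitivity: pure logic (instantiate the ∀κ of
ResponseFromTail at the κ of DefectTail); proof in hand (planner BC3 skeleton
LargeFieldInsensitivity_of, farm rc 0) -/
@[route_item "route-QuantumFields-TransverseWardBL"]
def LargeFieldInsensitivityOfSplit : Prop :=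
  DefectTail → ResponseFromTail → LargeFieldInsensitivity

-- `LargeFieldInsensitivityOfSplit` holds: proved by `Summit.QuantumFields.YangMills.Theorems.transverseWardBL_largeFieldInsensitivityOfSplit` (its module imports this route file, so no `_holds` link can be stated here).

/-- item stmt-QuantumFields-22929 · crux · rank 3 · open · by planner
why it might fail: BL needs a convex domain: after quotienting gauge/closed directions each sector {|dφ−2πm|∞≤1} is convex, but harmonic u see flux-sector MEANS ≈ 2πnL²; if the cut sector weights Z_n/Z_0 do not decay like e^(−cβ) uniformly in L, the 9/20 − 0.391 slack is eaten at moderate β.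
sources: BrascampLieb1976, HelfferSjostrand1994, DarioWu2020
[crux] X1. There is β₁ such that for all β > β₁, all M and every co-closed u: 0 < ⟨1_G⟩ and β⟨f_u²
1_G⟩ ≤ (9/20)|u|²⟨1_G⟩ — the transverse susceptibility of the small-field cut theory (weight
e^(βΣcos θ)·1_G, log-concave on each flux sector of exact 2-cochains) is at most 9/20 per unit norm,
uniformly in the volume (Brascamp–Lieb with the co-closed shift w' = u⊙(cos θ−1): pointwise constant
(1−cos 1)²/cos 1 = 0.391, plus Prékopa control of toron-flux sector means for harmonic u).
[difficulty: L] -/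
@[route_item "route-QuantumFields-TransverseWardBL"]
def ConvexPhaseTransverseBound : Prop :=
  ∃ β₁ : ℝ, ∀ β : ℝ, β₁ < β → ∀ M : ℕ, ∀ u : Literature.MathematicalPhysics.QuantumFieldTheory.Plaquette 4 (M + 1) → ℝ, (∀ e : Literature.MathematicalPhysics.QuantumFieldTheory.Edge 4 (M + 1), ∑ p : Literature.MathematicalPhysics.QuantumFieldTheory.Plaquette 4 (M + 1), (u) p * Literature.MathematicalPhysics.QuantumFieldTheory.LatticeForm.res (Literature.MathematicalPhysics.QuantumFieldTheory.LatticeForm.td₁ (fun (y : Literature.MathematicalPhysics.QuantumFieldTheory.Site 4 (M + 1)) (k : Fin 4) => if y = e.1 ∧ k = e.2 then (1 : ℝ) else 0)) p = 0) → 0 < ((fun (β : ℝ) (M : ℕ) => Literature.MathematicalPhysics.QuantumFieldTheory.wilsonExpectation (L := M + 1) Literature.MathematicalPhysics.QuantumLattice.u1Rep β (fun U : Literature.MathematicalPhysics.QuantumFieldTheory.GaugeConfig 4 (M + 1) Circle => (if (∀ p : Literature.MathematicalPhysics.QuantumFieldTheory.Plaquette 4 (M + 1), Real.cos 1 ≤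 ((Literature.MathematicalPhysics.QuantumFieldTheory.plaquetteHolonomy U p.1 p.2.1.1 p.2.1.2 : Circle) : ℂ).re) then (1 : ℝ) else 0))) β M) ∧ β * ((fun (β : ℝ) (M : ℕ) (w : Literature.MathematicalPhysics.QuantumFieldTheory.Plaquette 4 (M + 1) → ℝ) => Literature.MathematicalPhysics.QuantumFieldTheory.wilsonExpectation (L := M + 1) Literature.MathematicalPhysics.QuantumLattice.u1Rep β (fun U : Literature.MathematicalPhysics.QuantumFieldTheory.GaugeConfig 4 (M + 1) Circle => (∑ p : Literature.MathematicalPhysics.QuantumFieldTheory.Plaquette 4 (M + 1), (w) p * ((Literature.MathematicalPhysics.QuantumFieldTheory.plaquetteHolonomy U p.1 p.2.1.1 p.2.1.2 : Circle) : ℂ).im) ^ 2 * (if (∀ p : Literature.MathematicalPhysics.QuantumFieldTheory.Plaquette 4 (M + 1), Real.cos 1 ≤ ((Literature.MathematicalPhysics.QuantumFieldTheory.plaquetteHolonomy U p.1 p.2.1.1 p.2.1.2 : Circle) : ℂ).re) then (1 : ℝ) else 0))) β M u) ≤ (9 / 20 : ℝ) * (∑ p : Literature.MathematicalPhysics.QuantumFieldTheory.Plaquette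 4 (M + 1), ((u) p) ^ 2) * ((fun (β : ℝ) (M : ℕ) => Literature.MathematicalPhysics.QuantumFieldTheory.wilsonExpectation (L := M + 1) Literature.MathematicalPhysics.QuantumLattice.u1Rep β (fun U : Literature.MathematicalPhysics.QuantumFieldTheory.GaugeConfig 4 (M + 1) Circle => (if (∀ p : Literature.MathematicalPhysics.QuantumFieldTheory.Plaquette 4 (M + 1), Real.cos 1 ≤ ((Literature.MathematicalPhysics.QuantumFieldTheory.plaquetteHolonomy U p.1 p.2.1.1 p.2.1.2 : Circle) : ℂ).re) then (1 : ℝ) else 0))) β M)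

/-- item stmt-QuantumFields-23103 · crux · rank 3 · closed · proved by Summit.QuantumFields.YangMills.Theorems.TransverseWardBL.convexPhaseCoexactBound_proof (prover) · by planner
why it might fail: BL needs each flux sector of the cut to be ONE connected, translation-invariant component that is a bounded convex body in exact-form coordinates modulo flat closed-1-form directions; the hard wall |theta_p| = 1 must be smoothed by convex penalties with Hessian control in the limit.
sources: BrascampLieb1976, FrohlichSpencer1982, Guth1980
[crux] (LINE g9-C, rank 3, L; REPLACES ConvexPhaseTransverseBound 22929 in `closes`) Brascamp-Lieb
in the convex small-field phase for ZERO-MODE-FREE co-closed test forms u (co-closed AND all six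
orientation sums vanish): 0 < cutMass and beta <f_u^2 1_G> <= (9/20)|u|^2 <1_G>, uniformly in M. WHY
EASIER THAN 22929: inside the cut G every cube has |d theta| <= 6 < 2 pi, so theta is closed and G
splits into flux sectors k in Z^6, each translation invariant; hence the sector means m^(k)_p =
E_k[sin theta_p] are constant per orientation = harmonic, and (u, m^(k)) = 0 for zero-sum u - NO
flux-sector weights Z_k/Z_0 and no linear-response estimate are needed (that uniform-in-M
free-energy problem was the hidden hard part of 22929, critic note N2). What remains: per sector, in
exact-2-form coordinates F = h_k + dA (after quotienting the flat closed-1-form directions, on which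
weight and f_u do not depend) the cut measure is log-concave on a bounded convex body with Hessian
>= beta cos(1) on exact forms; Brascamp-Lieb (tree:
Literature.Probability.Distributions.BrascampLieb1976_thm41 / BrascampLieb1976_thm41_holds,
UniformlyConvexPoincare) with the D-weighted projection gives beta Var_k(f_u -/
@[route_item "route-QuantumFields-TransverseWardBL", crux]
def ConvexPhaseCoexactBound : Prop :=
  ∃ β₁ : ℝ, ∀ β : ℝ, β₁ < β → ∀ M : ℕ, ∀ u : Literature.MathematicalPhysics.QuantumFieldTheory.Plaquette 4 (M + 1) → ℝ, (∀ e : Literature.MathematicalPhysics.QuantumFieldTheory.Edge 4 (M + 1), ∑ p : Literature.MathematicalPhysics.QuantumFieldTheory.Plaquette 4 (M + 1), (u) p * Literature.MathematicalPhysics.QuantumFieldTheory.LatticeForm.res (Literature.MathematicalPhysics.QuantumFieldTheory.LatticeForm.td₁ (fun (y : Literature.MathematicalPhysics.QuantumFieldTheory.Site 4 (M + 1)) (k : Fin 4) => if y = e.1 ∧ k = e.2 then (1 : ℝ) else 0)) p = 0) → (∀ o : {p : Fin 4 × Fin 4 // p.1 < p.2}, (∑ q : Literature.MathematicalPhysics.QuantumFieldTheory.Plaquette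 4 (M + 1), (if q.2 = o then (u) q else 0)) = 0) → 0 < ((fun (β : ℝ) (M : ℕ) => Literature.MathematicalPhysics.QuantumFieldTheory.wilsonExpectation (L := M + 1) Literature.MathematicalPhysics.QuantumLattice.u1Rep β (fun U : Literature.MathematicalPhysics.QuantumFieldTheory.GaugeConfig 4 (M + 1) Circle => (if (∀ p : Literature.MathematicalPhysics.QuantumFieldTheory.Plaquette 4 (M + 1), Real.cos 1 ≤ ((Literature.MathematicalPhysics.QuantumFieldTheory.plaquetteHolonomy U p.1 p.2.1.1 p.2.1.2 : Circle) : ℂ).re) then (1 : ℝ) else 0))) β M) ∧ β * ((fun (β : ℝ) (M : ℕ) (w : Literature.MathematicalPhysics.QuantumFieldTheory.Plaquette 4 (M + 1) → ℝ) => Literature.MathematicalPhysics.QuantumFieldTheory.wilsonExpectation (L := M + 1) Literature.MathematicalPhysics.QuantumLattice.u1Rep β (fun U : Literature.MathematicalPhysics.QuantumFieldTheory.GaugeConfig 4 (M + 1) Circle => (∑ p : Literature.MathematicalPhysics.QuantumFieldTheory.Plaquette 4 (M + 1), (w) p * ((Literature.MathematicalPhysics.QuantumFieldTheory.plaquetteHolonomy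 U p.1 p.2.1.1 p.2.1.2 : Circle) : ℂ).im) ^ 2 * (if (∀ p : Literature.MathematicalPhysics.QuantumFieldTheory.Plaquette 4 (M + 1), Real.cos 1 ≤ ((Literature.MathematicalPhysics.QuantumFieldTheory.plaquetteHolonomy U p.1 p.2.1.1 p.2.1.2 : Circle) : ℂ).re) then (1 : ℝ) else 0))) β M u) ≤ (9 / 20 : ℝ) * (∑ p : Literature.MathematicalPhysics.QuantumFieldTheory.Plaquette 4 (M + 1), ((u) p) ^ 2) * ((fun (β : ℝ) (M : ℕ) => Literature.MathematicalPhysics.QuantumFieldTheory.wilsonExpectation (L := M + 1) Literature.MathematicalPhysics.QuantumLattice.u1Rep β (fun U : Literature.MathematicalPhysics.QuantumFieldTheory.GaugeConfig 4 (M + 1) Circle => (if (∀ p : Literature.MathematicalPhysics.QuantumFieldTheory.Plaquette 4 (M + 1), Real.cos 1 ≤ ((Literature.MathematicalPhysics.QuantumFieldTheory.plaquetteHolonomy U p.1 p.2.1.1 p.2.1.2 : Circle) : ℂ).re) then (1 : ℝ) else 0))) β M)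

-- `ConvexPhaseCoexactBound` holds: proved by `Summit.QuantumFields.YangMills.Theorems.TransverseWardBL.convexPhaseCoexactBound_proof` (its module imports this route file, so no `_holds` link can be stated here).

/-- item stmt-QuantumFields-22930 · support · rank 9 · closed · proved by Summit.QuantumFields.YangMills.Theorems.TransverseWardBL.wardPinning_proof (prover) · by planner
sources: Guth1980, FrohlichSpencer1982
[support] The Ward lever (provable now from `u1_torus_ward_identity` + translation/hyperoctahedral
invariance of the torus Wilson state + bilinearity/integrability): for β > 0, all M, every real
1-cochain α and every co-closed u, β·⟨f_(dα+u)²⟩ = torusMeanPlaq(β,M)·|dα|² + β·⟨f_u²⟩ (exact sector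
pinned at the mean plaquette, zero covariance with the transverse sector). [difficulty: M] -/
@[route_item "route-QuantumFields-TransverseWardBL", crux]
def WardPinning : Prop :=
  ∀ β : ℝ, 0 < β → ∀ M : ℕ, ∀ α : Literature.MathematicalPhysics.QuantumFieldTheory.Site 4 (M + 1) → Fin 4 → ℝ, ∀ u : Literature.MathematicalPhysics.QuantumFieldTheory.Plaquette 4 (M + 1) → ℝ, (∀ e : Literature.MathematicalPhysics.QuantumFieldTheory.Edge 4 (M + 1), ∑ p : Literature.MathematicalPhysics.QuantumFieldTheory.Plaquette 4 (M + 1), (u) p * Literature.MathematicalPhysics.QuantumFieldTheory.LatticeForm.res (Literature.MathematicalPhysics.QuantumFieldTheory.LatticeForm.td₁ (fun (y : Literature.MathematicalPhysics.QuantumFieldTheory.Site 4 (M + 1)) (k : Fin 4) => if y = e.1 ∧ k = e.2 then (1 : ℝ) else 0)) p = 0) → β * ((fun (β : ℝ) (M : ℕ) (w : Literature.MathematicalPhysics.QuantumFieldTheory.Plaquette 4 (M + 1) → ℝ) => Literature.MathematicalPhysics.QuantumFieldTheory.wilsonExpectation (L := M + 1) Literature.MathematicalPhysics.QuantumLattice.u1Rep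 β (fun U : Literature.MathematicalPhysics.QuantumFieldTheory.GaugeConfig 4 (M + 1) Circle => (∑ p : Literature.MathematicalPhysics.QuantumFieldTheory.Plaquette 4 (M + 1), (w) p * ((Literature.MathematicalPhysics.QuantumFieldTheory.plaquetteHolonomy U p.1 p.2.1.1 p.2.1.2 : Circle) : ℂ).im) ^ 2)) β M (fun p : Literature.MathematicalPhysics.QuantumFieldTheory.Plaquette 4 (M + 1) => Literature.MathematicalPhysics.QuantumFieldTheory.LatticeForm.res (Literature.MathematicalPhysics.QuantumFieldTheory.LatticeForm.td₁ α) p + u p)) = Summit.QuantumFields.YangMills.Theorems.U1Helicity.torusMeanPlaq β M * (∑ p : Literature.MathematicalPhysics.QuantumFieldTheory.Plaquette 4 (M + 1), (((fun p : Literature.MathematicalPhysics.QuantumFieldTheory.Plaquette 4 (M + 1) => Literature.MathematicalPhysics.QuantumFieldTheory.LatticeForm.res (Literature.MathematicalPhysics.QuantumFieldTheory.LatticeForm.td₁ α) p)) p) ^ 2) + β * ((fun (β : ℝ) (M : ℕ) (w : Literature.MathematicalPhysics.QuantumFieldTheory.Plaquette 4 (M + 1) → ℝ) => Literature.MathematicalPhysics.QuantumFieldTheory.wilsonExpectation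 (L := M + 1) Literature.MathematicalPhysics.QuantumLattice.u1Rep β (fun U : Literature.MathematicalPhysics.QuantumFieldTheory.GaugeConfig 4 (M + 1) Circle => (∑ p : Literature.MathematicalPhysics.QuantumFieldTheory.Plaquette 4 (M + 1), (w) p * ((Literature.MathematicalPhysics.QuantumFieldTheory.plaquetteHolonomy U p.1 p.2.1.1 p.2.1.2 : Circle) : ℂ).im) ^ 2)) β M u)

-- `WardPinning` holds: proved by `Summit.QuantumFields.YangMills.Theorems.TransverseWardBL.wardPinning_proof` (its module imports this route file, so no `_holds` link can be stated here).

/-- item stmt-QuantumFields-22931 · support · rank 9 · closed · proved by Summit.QuantumFields.YangMills.Theorems.TransverseWardBL.boxSecondMoment_proof (prover) · by planner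
sources: FrohlichSpencer1982
[support] Bookkeeping: the node's `torusBoxVar β M N` equals ⟨f_h²⟩ for the box form h_(N,M)(y;0,1)
= #{x ∈ B_N : x ≡ y mod M+1} (other orientations 0): bilinearity of the finite double sum,
`toTorusObservable`/`torusLift` periodisation of `u1PlaqIm`, integrability of bounded continuous
observables. [difficulty: provable-now] -/
@[route_item "route-QuantumFields-TransverseWardBL", crux]
def BoxSecondMoment : Prop :=
  ∀ β : ℝ, ∀ M N : ℕ, Summit.QuantumFields.YangMills.Theorems.U1Helicity.torusBoxVar β M N = ((fun (β : ℝ) (M : ℕ) (w : Literature.MathematicalPhysics.QuantumFieldTheory.Plaquette 4 (M + 1) → ℝ) => Literature.MathematicalPhysics.QuantumFieldTheory.wilsonExpectation (L := M + 1) Literature.MathematicalPhysics.QuantumLattice.u1Rep β (fun U : Literature.MathematicalPhysics.QuantumFieldTheory.GaugeConfig 4 (M + 1) Circle => (∑ p : Literature.MathematicalPhysics.QuantumFieldTheory.Plaquette 4 (M + 1), (w) p * ((Literature.MathematicalPhysics.QuantumFieldTheory.plaquetteHolonomy U p.1 p.2.1.1 p.2.1.2 : Circle) : ℂ).im) ^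 2)) β M (fun p : Literature.MathematicalPhysics.QuantumFieldTheory.Plaquette 4 (M + 1) => (if p.2.1 = ((0 : Fin 4), (1 : Fin 4)) then (((Literature.Probability.LatticeModels.box 4 N).filter (fun x => (fun i => ((x i : ℤ) : ZMod (M + 1))) = p.1)).card : ℝ) else 0)))

-- `BoxSecondMoment` holds: proved by `Summit.QuantumFields.YangMills.Theorems.TransverseWardBL.boxSecondMoment_proof` (its module imports this route file, so no `_holds` link can be stated here).

/-- item stmt-QuantumFields-22932 · support · rank 9 · closed · proved by Summit.QuantumFields.YangMills.Theorems.TransverseWardBL.boxHodgeSplit_proof (prover) · by planner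
sources: FrohlichSpencer1982, Guth1980
[support] Hodge split of the box form on the torus 2-cochains with the sharing fraction 1/2: for
every ε > 0, for N ≥ N₀(ε) and M ≥ M₀(N,ε) there are a real 1-cochain α and a co-closed u with
h_(N,M) = dα + u pointwise, |dα|² ≤ (1/2+ε)#B_N and |u|² ≤ (1/2+ε)#B_N (lattice Plancherel on
(ℤ/(M+1))⁴: exact fraction of a (0,1)-form has symbol (k̂₀²+k̂₁²)/|k̂|², whose Fejér average over a
cube → 2/4; shares the limit computation with U1DipoleHelicity's `FreeDipoleBoxMeanHalf`).
[difficulty: M] -/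
@[route_item "route-QuantumFields-TransverseWardBL", crux]
def BoxHodgeSplit : Prop :=
  ∀ ε : ℝ, 0 < ε → ∃ N₀ : ℕ, ∀ N : ℕ, N₀ ≤ N → ∃ M₀ : ℕ, ∀ M : ℕ, M₀ ≤ M → ∃ α : Literature.MathematicalPhysics.QuantumFieldTheory.Site 4 (M + 1) → Fin 4 → ℝ, ∃ u : Literature.MathematicalPhysics.QuantumFieldTheory.Plaquette 4 (M + 1) → ℝ, (∀ p : Literature.MathematicalPhysics.QuantumFieldTheory.Plaquette 4 (M + 1), (if p.2.1 = ((0 : Fin 4), (1 : Fin 4)) then (((Literature.Probability.LatticeModels.box 4 N).filter (fun x => (fun i => ((x i : ℤ) : ZMod (M + 1))) = p.1)).card : ℝ) else 0) = Literature.MathematicalPhysics.QuantumFieldTheory.LatticeForm.res (Literature.MathematicalPhysics.QuantumFieldTheory.LatticeForm.td₁ α) p + u p) ∧ (∀ e : Literature.MathematicalPhysics.QuantumFieldTheory.Edge 4 (M + 1), ∑ p : Literature.MathematicalPhysics.QuantumFieldTheory.Plaquette 4 (M + 1), (u) p * Literature.MathematicalPhysics.QuantumFieldTheory.LatticeForm.res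 (Literature.MathematicalPhysics.QuantumFieldTheory.LatticeForm.td₁ (fun (y : Literature.MathematicalPhysics.QuantumFieldTheory.Site 4 (M + 1)) (k : Fin 4) => if y = e.1 ∧ k = e.2 then (1 : ℝ) else 0)) p = 0) ∧ (∑ p : Literature.MathematicalPhysics.QuantumFieldTheory.Plaquette 4 (M + 1), (((fun p : Literature.MathematicalPhysics.QuantumFieldTheory.Plaquette 4 (M + 1) => Literature.MathematicalPhysics.QuantumFieldTheory.LatticeForm.res (Literature.MathematicalPhysics.QuantumFieldTheory.LatticeForm.td₁ α) p)) p) ^ 2) ≤ (1 / 2 + ε) * ((Literature.Probability.LatticeModels.box 4 N).card : ℝ) ∧ (∑ p : Literature.MathematicalPhysics.QuantumFieldTheory.Plaquette 4 (M + 1), ((u) p) ^ 2) ≤ (1 / 2 + ε) * ((Literature.Probability.LatticeModels.box 4 N).card : ℝ)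

-- `BoxHodgeSplit` holds: proved by `Summit.QuantumFields.YangMills.Theorems.TransverseWardBL.boxHodgeSplit_proof` (its module imports this route file, so no `_holds` link can be stated here).

/-- item stmt-QuantumFields-22933 · support · rank 9 · closed · proved by Summit.QuantumFields.YangMills.Theorems.TransverseWardBL.torusMeanPlaqLower_proof (prover) · by planner
sources: Guth1980
[support] For β > β₂ and all M, torusMeanPlaq(β,M) ≥ 9/10 (Ginibre comparison torus ≥ one plaquette,
tree `U1GinibreComparison`, and I₁(β)/I₀(β) ≥ 1 − 1/(2β) − …). [difficulty: provable-now] -/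
@[route_item "route-QuantumFields-TransverseWardBL", crux]
def TorusMeanPlaqLower : Prop :=
  ∃ β₂ : ℝ, ∀ β : ℝ, β₂ < β → ∀ M : ℕ, (9 / 10 : ℝ) ≤ Summit.QuantumFields.YangMills.Theorems.U1Helicity.torusMeanPlaq β M

-- `TorusMeanPlaqLower` holds: proved by `Summit.QuantumFields.YangMills.Theorems.TransverseWardBL.torusMeanPlaqLower_proof` (its module imports this route file, so no `_holds` link can be stated here).

/-- item stmt-QuantumFields-22934 · crux (kind.auto-crux: conjecture-grade) · rank 1 · closed · proved by Summit.QuantumFields.YangMills.Theorems.transverseWardBL_assembly (planner) · by planner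
why it might fail: auto-crux — conjecture-grade statement (statement references the registered conjecture Summit.QuantumFields.YangMills.Theorems.U1HelicityGapTorusD4); it is open, so it may simply be false
sources: FrohlichSpencer1982
[assembly] BoxSecondMoment → WardPinning → ConvexPhaseTransverseBound → LargeFieldInsensitivity →
BoxHodgeSplit → TorusMeanPlaqLower → U1HelicityGapTorusD4 (provable now; proof in hand). -/
@[route_item "route-QuantumFields-TransverseWardBL"]
def Assembly : Prop :=
  BoxSecondMoment → WardPinning → ConvexPhaseTransverseBound → LargeFieldInsensitivity → BoxHodgeSplit → TorusMeanPlaqLower → Summit.QuantumFields.YangMills.Theorems.U1HelicityGapTorusD4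

-- `Assembly` holds: proved by `Summit.QuantumFields.YangMills.Theorems.transverseWardBL_assembly` (its module imports this route file, so no `_holds` link can be stated here).

/-- item stmt-QuantumFields-23100 · support · rank 9 · closed · proved by Summit.QuantumFields.YangMills.Theorems.TransverseWardBL.zeroModeProjection_proof (prover) · by planner
[support] (LINE g9-C, S/M finite algebra) harmonic (zero-mode) projection of the co-closed part of
the box form: for boxForm = d alpha + u with u co-closed, the orientation-mean-free part v_p = u_p -
(sum over plaquettes q of the same orientation of u_q)/(M+1)^4 is co-closed (constant 2-forms are
co-closed on the torus), has zero orientation sums, |v|^2 <= |u|^2 (orthogonal projection), and |u -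
v|^2 <= #B_N^2/(M+1)^4 (orientation sums of an exact form vanish; the (0,1)-sum of boxForm is #B_N,
the number of plaquettes per orientation is (M+1)^4). Sources: folklore (discrete Hodge theory on
the torus); tree AbelianTorusCochains. -/
@[route_item "route-QuantumFields-TransverseWardBL", crux]
def ZeroModeProjection : Prop :=
  ∀ M N : ℕ, ∀ α : Literature.MathematicalPhysics.QuantumFieldTheory.Site 4 (M + 1) → Fin 4 → ℝ, ∀ u : Literature.MathematicalPhysics.QuantumFieldTheory.Plaquette 4 (M + 1) → ℝ, (∀ p : Literature.MathematicalPhysics.QuantumFieldTheory.Plaquette 4 (M + 1), (if p.2.1 = ((0 : Fin 4), (1 : Fin 4)) then (((Literature.Probability.LatticeModels.box 4 N).filter (fun x => (fun i => ((x i : ℤ) : ZMod (M + 1))) = p.1)).card : ℝ) else 0) = Literature.MathematicalPhysics.QuantumFieldTheory.LatticeForm.res (Literature.MathematicalPhysics.QuantumFieldTheory.LatticeForm.td₁ α) p + u p) → (∀ e : Literature.MathematicalPhysics.QuantumFieldTheory.Edge 4 (M + 1), ∑ p : Literature.MathematicalPhysics.QuantumFieldTheory.Plaquette 4 (M + 1),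 (u) p * Literature.MathematicalPhysics.QuantumFieldTheory.LatticeForm.res (Literature.MathematicalPhysics.QuantumFieldTheory.LatticeForm.td₁ (fun (y : Literature.MathematicalPhysics.QuantumFieldTheory.Site 4 (M + 1)) (k : Fin 4) => if y = e.1 ∧ k = e.2 then (1 : ℝ) else 0)) p = 0) → (∀ e : Literature.MathematicalPhysics.QuantumFieldTheory.Edge 4 (M + 1), ∑ p : Literature.MathematicalPhysics.QuantumFieldTheory.Plaquette 4 (M + 1), (((fun (M : ℕ) (u : Literature.MathematicalPhysics.QuantumFieldTheory.Plaquette 4 (M + 1) → ℝ) (p : Literature.MathematicalPhysics.QuantumFieldTheory.Plaquette 4 (M + 1)) => u p - (∑ q : Literature.MathematicalPhysics.QuantumFieldTheory.Plaquette 4 (M + 1), (if q.2 = p.2 then u q else 0)) / (((M : ℝ) + 1) ^ 4)) M u)) p * Literature.MathematicalPhysics.QuantumFieldTheory.LatticeForm.res (Literature.MathematicalPhysics.QuantumFieldTheory.LatticeForm.td₁ (fun (y : Literature.MathematicalPhysics.QuantumFieldTheory.Site 4 (M + 1)) (k : Fin 4) => if y = e.1 ∧ k = e.2 then (1 : ℝ)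 else 0)) p = 0) ∧ (∀ o : {p : Fin 4 × Fin 4 // p.1 < p.2}, (∑ q : Literature.MathematicalPhysics.QuantumFieldTheory.Plaquette 4 (M + 1), (if q.2 = o then (((fun (M : ℕ) (u : Literature.MathematicalPhysics.QuantumFieldTheory.Plaquette 4 (M + 1) → ℝ) (p : Literature.MathematicalPhysics.QuantumFieldTheory.Plaquette 4 (M + 1)) => u p - (∑ q : Literature.MathematicalPhysics.QuantumFieldTheory.Plaquette 4 (M + 1), (if q.2 = p.2 then u q else 0)) / (((M : ℝ) + 1) ^ 4)) M u)) q else 0)) = 0) ∧ (∑ p : Literature.MathematicalPhysics.QuantumFieldTheory.Plaquette 4 (M + 1), ((((fun (M : ℕ) (u : Literature.MathematicalPhysics.QuantumFieldTheory.Plaquette 4 (M + 1) → ℝ) (p : Literature.MathematicalPhysics.QuantumFieldTheory.Plaquette 4 (M + 1)) => u p - (∑ q : Literature.MathematicalPhysics.QuantumFieldTheory.Plaquette 4 (M + 1), (if q.2 = p.2 then u q else 0)) / (((M : ℝ) + 1) ^ 4)) M u)) p) ^ 2) ≤ (∑ p : Literature.MathematicalPhysics.QuantumFieldTheory.Plaquette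 4 (M + 1), ((u) p) ^ 2) ∧ (∑ p : Literature.MathematicalPhysics.QuantumFieldTheory.Plaquette 4 (M + 1), (((fun p : Literature.MathematicalPhysics.QuantumFieldTheory.Plaquette 4 (M + 1) => u p - ((fun (M : ℕ) (u : Literature.MathematicalPhysics.QuantumFieldTheory.Plaquette 4 (M + 1) → ℝ) (p : Literature.MathematicalPhysics.QuantumFieldTheory.Plaquette 4 (M + 1)) => u p - (∑ q : Literature.MathematicalPhysics.QuantumFieldTheory.Plaquette 4 (M + 1), (if q.2 = p.2 then u q else 0)) / (((M : ℝ) + 1) ^ 4)) M u) p)) p) ^ 2) ≤ ((Literature.Probability.LatticeModels.box 4 N).card : ℝ) ^ 2 / (((M : ℝ) + 1) ^ 4)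

-- `ZeroModeProjection` holds: proved by `Summit.QuantumFields.YangMills.Theorems.TransverseWardBL.zeroModeProjection_proof` (its module imports this route file, so no `_holds` link can be stated here).

/-- item stmt-QuantumFields-23101 · support · rank 9 · closed · proved by Summit.QuantumFields.YangMills.Theorems.TransverseWardBL.smSubadd_proof (prover) · by planner
[support] (LINE g9-C, S) the Wilson-state second moment SM(beta,M,w) = <f_w^2> is a positive
quadratic functional of the test form: SM(v+w) <= (1+eta) SM(v) + (1+1/eta) SM(w) for eta > 0, from
f_{v+w} = f_v + f_w pointwise, (a+b)^2 <= (1+eta)a^2 + (1+1/eta)b^2 and positivity/linearity of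
wilsonExpectation (a probability expectation at every real beta). Sources: folklore. -/
@[route_item "route-QuantumFields-TransverseWardBL", crux]
def SMSubadd : Prop :=
  ∀ β : ℝ, ∀ M : ℕ, ∀ v w : Literature.MathematicalPhysics.QuantumFieldTheory.Plaquette 4 (M + 1) → ℝ, ∀ η : ℝ, 0 < η → ((fun (β : ℝ) (M : ℕ) (w : Literature.MathematicalPhysics.QuantumFieldTheory.Plaquette 4 (M + 1) → ℝ) => Literature.MathematicalPhysics.QuantumFieldTheory.wilsonExpectation (L := M + 1) Literature.MathematicalPhysics.QuantumLattice.u1Rep β (fun U : Literature.MathematicalPhysics.QuantumFieldTheory.GaugeConfig 4 (M + 1) Circle => (∑ p : Literature.MathematicalPhysics.QuantumFieldTheory.Plaquette 4 (M + 1), (w) p * ((Literature.MathematicalPhysics.QuantumFieldTheory.plaquetteHolonomy U p.1 p.2.1.1 p.2.1.2 : Circle) : ℂ).im) ^ 2)) β M (fun p : Literature.MathematicalPhysics.QuantumFieldTheory.Plaquette 4 (M + 1) => v p + w p)) ≤ (1 + η) * ((fun (β : ℝ) (M : ℕ) (w : Literature.MathematicalPhysics.QuantumFieldTheory.Plaquette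 4 (M + 1) → ℝ) => Literature.MathematicalPhysics.QuantumFieldTheory.wilsonExpectation (L := M + 1) Literature.MathematicalPhysics.QuantumLattice.u1Rep β (fun U : Literature.MathematicalPhysics.QuantumFieldTheory.GaugeConfig 4 (M + 1) Circle => (∑ p : Literature.MathematicalPhysics.QuantumFieldTheory.Plaquette 4 (M + 1), (w) p * ((Literature.MathematicalPhysics.QuantumFieldTheory.plaquetteHolonomy U p.1 p.2.1.1 p.2.1.2 : Circle) : ℂ).im) ^ 2)) β M v) + (1 + 1 / η) * ((fun (β : ℝ) (M : ℕ) (w : Literature.MathematicalPhysics.QuantumFieldTheory.Plaquette 4 (M + 1) → ℝ) => Literature.MathematicalPhysics.QuantumFieldTheory.wilsonExpectation (L := M + 1) Literature.MathematicalPhysics.QuantumLattice.u1Rep β (fun U : Literature.MathematicalPhysics.QuantumFieldTheory.GaugeConfig 4 (M + 1) Circle => (∑ p : Literature.MathematicalPhysics.QuantumFieldTheory.Plaquette 4 (M + 1), (w) p * ((Literature.MathematicalPhysics.QuantumFieldTheory.plaquetteHolonomy U p.1 p.2.1.1 p.2.1.2 : Circle) : ℂ).im) ^ 2)) β M w)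

-- `SMSubadd` holds: proved by `Summit.QuantumFields.YangMills.Theorems.TransverseWardBL.smSubadd_proof` (its module imports this route file, so no `_holds` link can be stated here).

/-- item stmt-QuantumFields-23102 · support · rank 9 · closed · proved by Summit.QuantumFields.YangMills.Theorems.TransverseWardBL.infraredBound_proof (prover) · by planner
[support] (LINE g9-C; size M/L — the tree has NO general U(1) character expansion yet; the
reflection-positivity route (tree: OneCharacterTwistBound / ConstructiveQFTWave0Proofs machinery)
only covers EVEN torus side, and the node quantifies over all large M) the delta = 0 infrared
(Gaussian-domination) bound for Wilson U(1)_4 on every torus: beta <f_h^2> <= |h|^2 for all real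
2-forms h and beta > 0, f_h = sum_p h_p sin theta_p. PROOF PLAN (all M): (1) Fourier positivity:
exp(beta cos x) = sum_n I_n(beta) e^{inx} with I_n(beta) = (1/2pi) int e^{beta cos x} cos(nx) dx >=
0 (elementary: e^{beta cos} = sum_k beta^k cos^k/k!, and cos^k has non-negative Fourier coefficients
by the binomial expansion of ((e^{ix}+e^{-ix})/2)^k); (2) integrate the links: Z(h) := int prod_p
exp(beta cos((d theta)_p + h_p)) = (2pi)^{#links} sum over CO-CLOSED integer 2-forms n of prod_p
I_{n_p}(beta) cos((n,h)) <= Z(0) for EVERY real h (including constant = harmonic h: this is a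
zero-momentum statement and it is still true, because the zero mode of an exact form vanishes
identically); Z(h) = Z(-h) by theta -> -theta; (3) t -> log Z(t h) is smooth, even, with a global
max at t = 0, so its second derivative at -/
@[route_item "route-QuantumFields-TransverseWardBL", crux]
def InfraredBound : Prop :=
  ∀ β : ℝ, 0 < β → ∀ M : ℕ, ∀ h : Literature.MathematicalPhysics.QuantumFieldTheory.Plaquette 4 (M + 1) → ℝ, β * ((fun (β : ℝ) (M : ℕ) (w : Literature.MathematicalPhysics.QuantumFieldTheory.Plaquette 4 (M + 1) → ℝ) => Literature.MathematicalPhysics.QuantumFieldTheory.wilsonExpectation (L := M + 1) Literature.MathematicalPhysics.QuantumLattice.u1Rep β (fun U : Literature.MathematicalPhysics.QuantumFieldTheory.GaugeConfig 4 (M + 1) Circle => (∑ p : Literature.MathematicalPhysics.QuantumFieldTheory.Plaquette 4 (M + 1), (w) p * ((Literature.MathematicalPhysics.QuantumFieldTheory.plaquetteHolonomy U p.1 p.2.1.1 p.2.1.2 : Circle) : ℂ).im) ^ 2)) β M h) ≤ (∑ p : Literature.MathematicalPhysics.QuantumFieldTheory.Plaquette 4 (M + 1), ((h) p) ^ 2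)

-- `InfraredBound` holds: proved by `Summit.QuantumFields.YangMills.Theorems.TransverseWardBL.infraredBound_proof` (its module imports this route file, so no `_holds` link can be stated here).

/-- item stmt-QuantumFields-23161 · aside · rank 9 · open · by planner
[aside; DOCKING PORT, LINE g9-C] cut-free transverse half-bound: there is beta_1 such that for beta
> beta_1, every torus side M+1 and every CO-CLOSED ZERO-SUM real 2-form v, beta * W_beta[(sum_p v_p
Im U_p)^2] <= (1/2) * sum_p v_p^2. This is the ONLY hard-side input the node needs (Assembly3,
proved); the route's cut decomposition supplies it (HalfBoundOfCut: ConvexPhaseCoexactBound 23103 +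
LargeFieldInsensitivity 22928 => this, proved), and so would a dual-current stiffness bound
Upsilon_M(v) >= (c - 1/2) beta |v|^2 on co-exact test forms (route WilsonVillainDualStiffness
restricted; evidence idea coexact-dual-stiffness on 23009). MC (kit j315365/j315366):
beta<f_v^2>/|v|^2 = 0.055 (beta=1.1), 0.007 (beta=2), 0.002 (beta=3), L-stable 4^4..8^4. Banked: not
staffed; other routes may attach. -/
@[route_item "route-QuantumFields-TransverseWardBL"]
def TransverseHalfBound : Prop :=
  ∃ β₁ : ℝ, ∀ β : ℝ, β₁ < β → ∀ M : ℕ, ∀ v : Literature.MathematicalPhysics.QuantumFieldTheory.Plaquette 4 (M + 1) → ℝ, (∀ e : Literature.MathematicalPhysics.QuantumFieldTheory.Edge 4 (M + 1), ∑ p : Literature.MathematicalPhysics.QuantumFieldTheory.Plaquette 4 (M + 1), (v) p * Literature.MathematicalPhysics.QuantumFieldTheory.LatticeForm.res (Literature.MathematicalPhysics.QuantumFieldTheory.LatticeForm.td₁ (fun (y : Literature.MathematicalPhysics.QuantumFieldTheory.Site 4 (M + 1)) (k : Fin 4) => if y = e.1 ∧ k = e.2 then (1 : ℝ) else 0)) p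 = 0) → (∀ o : {p : Fin 4 × Fin 4 // p.1 < p.2}, (∑ q : Literature.MathematicalPhysics.QuantumFieldTheory.Plaquette 4 (M + 1), (if q.2 = o then (v) q else 0)) = 0) → β * ((fun (β : ℝ) (M : ℕ) (w : Literature.MathematicalPhysics.QuantumFieldTheory.Plaquette 4 (M + 1) → ℝ) => Literature.MathematicalPhysics.QuantumFieldTheory.wilsonExpectation (L := M + 1) Literature.MathematicalPhysics.QuantumLattice.u1Rep β (fun U : Literature.MathematicalPhysics.QuantumFieldTheory.GaugeConfig 4 (M + 1) Circle => (∑ p : Literature.MathematicalPhysics.QuantumFieldTheory.Plaquette 4 (M + 1), (w) p * ((Literature.MathematicalPhysics.QuantumFieldTheory.plaquetteHolonomy U p.1 p.2.1.1 p.2.1.2 : Circle) : ℂ).im) ^ 2)) β M v) ≤ (1 / 2 : ℝ) * (∑ p : Literature.MathematicalPhysics.QuantumFieldTheory.Plaquette 4 (M + 1), ((v) p) ^ 2)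

/-- item stmt-QuantumFields-23162 · aside · rank 9 · closed · proved by Summit.QuantumFields.YangMills.Theorems.transverseWardBL_halfBoundOfCut (planner) · by planner
[aside; proved glue, LINE g9-C] ConvexPhaseCoexactBound -> LargeFieldInsensitivity ->
TransverseHalfBound: (9/20 + 1/20) * cutMass sandwich divided by cutMass > 0. -/
@[route_item "route-QuantumFields-TransverseWardBL"]
def HalfBoundOfCut : Prop :=
  Summit.QuantumFields.YangMills.Theses.TransverseWardBL.ConvexPhaseCoexactBound → Summit.QuantumFields.YangMills.Theses.TransverseWardBL.LargeFieldInsensitivity → Summit.QuantumFields.YangMills.Theses.TransverseWardBL.TransverseHalfBound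

-- `HalfBoundOfCut` holds: proved by `Summit.QuantumFields.YangMills.Theorems.transverseWardBL_halfBoundOfCut` (its module imports this route file, so no `_holds` link can be stated here).

/-- item stmt-QuantumFields-23163 · aside · rank 9 · closed · proved by Summit.QuantumFields.YangMills.Theorems.transverseWardBL_assembly3 (planner) · by planner
[aside; proved alt assembly, LINE g9-C] TorusMeanPlaqLower -> BoxSecondMoment -> BoxHodgeSplit ->
WardPinning -> ZeroModeProjection -> SMSubadd -> InfraredBound -> TransverseHalfBound ->
U1HelicityGapTorusD4 (delta = 1/10, eta = 1/100, M_0(N) >= 10100 #B_N); proof = arithmetic of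
transverseWardBL_assembly2 with the cut sandwich replaced by the half-bound hypothesis. -/
@[route_item "route-QuantumFields-TransverseWardBL"]
def Assembly3 : Prop :=
  Summit.QuantumFields.YangMills.Theses.TransverseWardBL.TorusMeanPlaqLower → Summit.QuantumFields.YangMills.Theses.TransverseWardBL.BoxSecondMoment → Summit.QuantumFields.YangMills.Theses.TransverseWardBL.BoxHodgeSplit → Summit.QuantumFields.YangMills.Theses.TransverseWardBL.WardPinning → Summit.QuantumFields.YangMills.Theses.TransverseWardBL.ZeroModeProjection → Summit.QuantumFields.YangMills.Theses.TransverseWardBL.SMSubadd → Summit.QuantumFields.YangMills.Theses.TransverseWardBL.InfraredBound → Summit.QuantumFields.YangMills.Theses.TransverseWardBL.TransverseHalfBound → Summit.QuantumFields.YangMills.Theorems.U1HelicityGapTorusD4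

-- `Assembly3` holds: proved by `Summit.QuantumFields.YangMills.Theorems.transverseWardBL_assembly3` (its module imports this route file, so no `_holds` link can be stated here).

/-- item stmt-QuantumFields-23104 · assembly · rank 9 · closed · proved by Summit.QuantumFields.YangMills.Theorems.transverseWardBL_assembly2 (planner) · by planner
[support] (LINE g9-C glue; proof in hand, lands at once) zero-mode-free assembly: TorusMeanPlaqLower
-> BoxSecondMoment -> BoxHodgeSplit -> WardPinning -> ZeroModeProjection -> SMSubadd ->
InfraredBound -> ConvexPhaseCoexactBound -> LargeFieldInsensitivity -> U1HelicityGapTorusD4.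
Arithmetic: epsilon = 1/20, eta = 1/100, delta = 1/10, M_0(N) >= 10100 #B_N so that the harmonic
part costs <= #B_N/100 via the infrared bound; needs c >= 0.862, have c >= 9/10. Replaces Assembly
22934 (proved, p652461) as the deciding chain; 22929 and 22934 become asides. -/
@[route_item "route-QuantumFields-TransverseWardBL", crux]
def Assembly2 : Prop :=
  Summit.QuantumFields.YangMills.Theses.TransverseWardBL.TorusMeanPlaqLower → Summit.QuantumFields.YangMills.Theses.TransverseWardBL.BoxSecondMoment → Summit.QuantumFields.YangMills.Theses.TransverseWardBL.BoxHodgeSplit → Summit.QuantumFields.YangMills.Theses.TransverseWardBL.WardPinning → Summit.QuantumFields.YangMills.Theses.TransverseWardBL.ZeroModeProjection → Summit.QuantumFields.YangMills.Theses.TransverseWardBL.SMSubadd → Summit.QuantumFields.YangMills.Theses.TransverseWardBL.InfraredBound → Summit.QuantumFields.YangMills.Theses.TransverseWardBL.ConvexPhaseCoexactBound → Summit.QuantumFields.YangMills.Theses.TransverseWardBL.LargeFieldInsensitivity → Summit.QuantumFields.YangMills.Theorems.U1HelicityGapTorusD4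

-- `Assembly2` holds: proved by `Summit.QuantumFields.YangMills.Theorems.transverseWardBL_assembly2` (its module imports this route file, so no `_holds` link can be stated here).

/-! D-0027 §2.1 — DECIDING THEOREM (planner-authored via `route open/edit --closes-file`; by planner-ym-idea-4-g9-0 2026-08-28T18:25:49Z):
its hypotheses are this route's items and its conclusion the sub-problem Statement (glue_lint), and it elaborates with this file. -/

@[closes "route-QuantumFields-TransverseWardBL"] theorem closes (hA2 : Summit.QuantumFields.YangMills.Theses.TransverseWardBL.Assembly2) (h4 : Summit.QuantumFields.YangMills.Theses.TransverseWardBL.TorusMeanPlaqLower) (h0 : Summit.QuantumFields.YangMills.Theses.TransverseWardBL.BoxSecondMoment) (h3 : Summit.QuantumFields.YangMills.Theses.TransverseWardBL.BoxHodgeSplit)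
    (h1 : Summit.QuantumFields.YangMills.Theses.TransverseWardBL.WardPinning) (hZ : Summit.QuantumFields.YangMills.Theses.TransverseWardBL.ZeroModeProjection) (hS : Summit.QuantumFields.YangMills.Theses.TransverseWardBL.SMSubadd) (hI : Summit.QuantumFields.YangMills.Theses.TransverseWardBL.InfraredBound)
    (h2a : Summit.QuantumFields.YangMills.Theses.TransverseWardBL.ConvexPhaseCoexactBound) (h2b : Summit.QuantumFields.YangMills.Theses.TransverseWardBL.LargeFieldInsensitivity) :
    Summit.QuantumFields.YangMills.Theorems.U1HelicityGapTorusD4 :=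
  hA2 h4 h0 h3 h1 hZ hS hI h2a h2b

end Summit.QuantumFields.YangMills.Theses.TransverseWardBL
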